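import Summits.AtomisticToContinuum.BoseEinsteinCondensation.Theorems.BECGroundStateSOSIRModeCounting
import Summits.AtomisticToContinuum.BoseEinsteinCondensation.Theorems.PeriodicIRBound.Negative.GroundOccupation
import HarnessLib

/-!
# Route `BECSectorPoincareTwoScale`, support item `LandauToPeriodicBEC` (stmt-AtomisticToContinuum-9095) —
# helper I: mode counting on the torus, PER POTENTIAL

The landed item `BECGroundStateSOS.IRModeCounting` (stmt-AtomisticToContinuum-4246,
`Theorems.IRModeCounting_proof`) derives torus condensation of near-minimisers from the T = 0 infrared bound
`n_k(Ψ) ≤ C√ρ L_N/‖k‖_∞` with BOTH sides quantified over all admissible potentials. The bridge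
`LandauToPeriodicBEC` is an implication for ONE potential `v`, so it needs the same counting per potential:
`IRBoundFor v → PeriodicBEC-body(v)` (`periodicBEC_of_irBoundFor`). The proof is the one of
`IRModeCounting_proof` (its abstract counting step `ModeCounting.condensate_ge_half` is reused verbatim; only the
instantiation of the infrared hypothesis changes): Parseval `∑_k n_k = N`, the kinetic Markov bound above the
window with the Dyson–LSSY upper bound `E₀^per ≤ AρN` (`LSSY2005_upperBound_periodic_holds`), the harmonic shell
sum `∑_{0<‖k‖_∞≤M} 1/‖k‖_∞ ≤ 26M²`, whence `n₀ ≥ N/2`.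

References: [LSSY2005] Lieb–Seiringer–Solovej–Yngvason, *The Mathematics of the Bose Gas and its
Condensation* (2005), Thm. 2.2 (2.14), §1.2 (1.17)–(1.19); [KLS1988PRL] Kennedy–Lieb–Shastry, Phys. Rev.
Lett. 61 (1988) 2582 (IR bound ⇒ LRO).
-/

noncomputable section

open MeasureTheory Filter
open scoped ENNReal NNReal BigOperators

namespace Summit.AtomisticToContinuum.BoseEinsteinCondensation.Theorems.LandauToPeriodicBEC

open Literature.MathematicalPhysics.QuantumManyBody.BoseGas
open Summit.AtomisticToContinuum.BoseEinsteinCondensation.Theorems.ModeCounting (condensate_ge_half)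
open Summit.AtomisticToContinuum.BoseEinsteinCondensation.Theorems.PeriodicIRBound.Negative
  (IRBoundFor NearMin InWindow IRIneq)

/-- **Mode counting on the torus, per potential.** For ONE repulsive finite-range `v`, the T = 0 infrared
bound `IRBoundFor v` (`n_k(Ψ) ≤ C√ρ L_N/‖k‖_∞` on every window `0 < ‖k‖_∞ ≤ κ√ρ L_N` for the
`δ_N`-near-minimisers, eventually in `N`, for all small `ρ`) implies condensation `⟨Ψ, n₀Ψ⟩ ≥ N/2` of the
`δ_N`-near-minimisers on the torus of side `L_N = (N/ρ)^{1/3}` at every small density — the body of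
`PeriodicBEC` for `v` with `c = 1/2`. Constants as in `IRModeCounting_proof`: `κ² = (A+1)/π²`,
`A = 4πa(1 + C₁c₁)` (LSSY Thm. 2.2), `√ρ < 1/(104Cκ²)`, `ρ` below the LSSY threshold.
[cite: LSSY2005, Thm. 2.2 (2.14) and §1.2 (1.17)–(1.19)] -/
theorem periodicBEC_of_irBoundFor (v : ℝ → ℝ≥0∞) (hv : IsRepulsiveFiniteRange v) (hX : IRBoundFor v) :
    ∃ ρ₀ : ℝ, 0 < ρ₀ ∧ ∀ ρ : ℝ, 0 < ρ → ρ < ρ₀ → ∃ c : ℝ, 0 < c ∧ ∀ᶠ N : ℕ in Filter.atTop,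
      ∃ δ : ℝ≥0∞, 0 < δ ∧ ∀ Ψ : PeriodicTrialState N (sideLength ρ N),
        periodicEnergy v Ψ ≤ periodicGroundStateEnergy v N (sideLength ρ N) + δ →
          ENNReal.ofReal (c * N) ≤ condensateOccupation N (sideLength ρ N) Ψ.ψ := by
  -- constants attached to `v`: range, scattering length, the LSSY upper bound
  obtain ⟨R, hR, hvR⟩ := hv.exists_pos_range
  obtain ⟨C₁, c₁, hC₁, hc₁, hLSSY⟩ :=
    LSSY2005_upperBound_periodic_holds v R hv.1 hvR hv.scatteringLength_ne_top
  set a : ℝ := (scatteringLength v).toReal with ha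
  have ha0 : 0 ≤ a := ENNReal.toReal_nonneg
  set A : ℝ := 4 * Real.pi * a * (1 + C₁ * c₁) with hA
  have hA0 : 0 ≤ A := by positivity
  set κ : ℝ := Real.sqrt (A + 1) / Real.pi with hκ
  have hκ0 : 0 < κ := by positivity
  have hκ2 : Real.pi ^ 2 * κ ^ 2 = A + 1 := by
    rw [hκ, div_pow, Real.sq_sqrt (by positivity)]
    field_simp
  obtain ⟨ρX, hρX, C, hC, hXv⟩ := hX κ hκ0
  -- density thresholds
  set ρa : ℝ := 3 * (c₁ / (a + 1)) ^ 3 / (4 * Real.pi) with hρa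
  have hρa0 : 0 < ρa := by positivity
  set ρC : ℝ := (1 / (104 * C * κ ^ 2)) ^ 2 with hρC
  have hρC0 : 0 < ρC := by positivity
  refine ⟨min ρX (min ρa ρC), lt_min hρX (lt_min hρa0 hρC0), fun ρ hρ hρ₀ => ?_⟩
  have hρX' : ρ < ρX := lt_of_lt_of_le hρ₀ (min_le_left _ _)
  have hρa' : ρ < ρa := lt_of_lt_of_le hρ₀ ((min_le_right _ _).trans (min_le_left _ _))
  have hρC' : ρ < ρC := lt_of_lt_of_le hρ₀ ((min_le_right _ _).trans (min_le_right _ _))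
  -- consequences of the thresholds
  have hsmall : (a + 1) * (4 * Real.pi * ρ / 3) ^ ((1 : ℝ) / 3) < c₁ := by
    have h1 : 4 * Real.pi * ρ / 3 < (c₁ / (a + 1)) ^ 3 := by
      rw [hρa, lt_div_iff₀ (by positivity)] at hρa'
      rw [div_lt_iff₀ (by norm_num : (0 : ℝ) < 3)]
      linarith
    have h2 : (4 * Real.pi * ρ / 3) ^ ((1 : ℝ) / 3) < c₁ / (a + 1) := by
      calc (4 * Real.pi * ρ / 3) ^ ((1 : ℝ) / 3) < ((c₁ / (a + 1)) ^ 3) ^ ((1 : ℝ) / 3) :=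
            Real.rpow_lt_rpow (by positivity) h1 (by norm_num)
        _ = c₁ / (a + 1) := by
            rw [show ((1 : ℝ) / 3) = ((3 : ℕ) : ℝ)⁻¹ by norm_num,
              Real.pow_rpow_inv_natCast (by positivity) (by norm_num)]
    calc (a + 1) * (4 * Real.pi * ρ / 3) ^ ((1 : ℝ) / 3) < (a + 1) * (c₁ / (a + 1)) := by
          gcongr
      _ = c₁ := by field_simp
  have hsqrtρ : 104 * C * κ ^ 2 * Real.sqrt ρ ≤ 1 := by
    have h1 : Real.sqrt ρ < 1 / (104 * C * κ ^ 2) := by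
      calc Real.sqrt ρ < Real.sqrt ρC := Real.sqrt_lt_sqrt hρ.le hρC'
        _ = 1 / (104 * C * κ ^ 2) := by rw [hρC, Real.sqrt_sq (by positivity)]
    rw [lt_div_iff₀ (by positivity)] at h1
    linarith
  -- the answer: `c = 1/2`, eventually in `N`
  refine ⟨1 / 2, by norm_num, ?_⟩
  filter_upwards [hXv ρ hρ hρX', eventually_ge_atTop 2,
    (tendsto_sideLength_atTop hρ).eventually_gt_atTop (2 * R)] with N ⟨δX, hδX, hXN⟩ hN2 hRL
  have hN : 0 < N := lt_of_lt_of_le two_pos hN2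
  have hNr : (0 : ℝ) < N := Nat.cast_pos.2 hN
  set L : ℝ := sideLength ρ N with hLdef
  have hL : 0 < L := Real.rpow_pos_of_pos (div_pos hNr hρ) _
  have hL3 : ρ * L ^ 3 = N := by
    rw [hLdef, sideLength_pow_three hρ N]
    field_simp
  -- the energy bound `E₀^per ≤ A ρ N` (LSSY Thm. 2.2 with `ρ₁ ≤ ρ`, `a/b ≤ c₁`)
  have hE0 : periodicGroundStateEnergy v N L ≤ ENNReal.ofReal (A * ρ * N) := by
    have hL1 := hLSSY N L hN2 hL hRL
    simp only [] at hL1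
    set ρ₁ : ℝ := ((N : ℝ) - 1) / L ^ 3 with hρ₁
    have hN2r : (2 : ℝ) ≤ N := by exact_mod_cast hN2
    have hρ₁0 : 0 ≤ ρ₁ := div_nonneg (by linarith) (by positivity)
    have hρ₁ρ : ρ₁ ≤ ρ := by
      rw [hρ₁, div_le_iff₀ (by positivity), hL3]
      linarith
    have hx : a * (4 * Real.pi * ρ₁ / 3) ^ ((1 : ℝ) / 3) ≤ c₁ := by
      have h1 : (4 * Real.pi * ρ₁ / 3) ^ ((1 : ℝ) / 3) ≤ (4 * Real.pi * ρ / 3) ^ ((1 : ℝ) / 3) :=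
        Real.rpow_le_rpow (by positivity) (by gcongr) (by norm_num)
      calc a * (4 * Real.pi * ρ₁ / 3) ^ ((1 : ℝ) / 3)
          ≤ (a + 1) * (4 * Real.pi * ρ / 3) ^ ((1 : ℝ) / 3) :=
            mul_le_mul (by linarith) h1 (by positivity) (by positivity)
        _ ≤ c₁ := hsmall.le
    have hL2 := hL1 (by rw [div_rpow_neg_third (by positivity)]; exact hx)
    rw [div_rpow_neg_third (by positivity)] at hL2
    refine hL2.trans (ENNReal.ofReal_le_ofReal ?_)
    rw [hA]
    calc 4 * Real.pi * ρ₁ * a * (1 + C₁ * (a * (4 * Real.pi * ρ₁ / 3) ^ ((1 : ℝ) / 3))) * N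
        ≤ 4 * Real.pi * ρ * a * (1 + C₁ * c₁) * N := by gcongr
      _ = 4 * Real.pi * a * (1 + C₁ * c₁) * ρ * N := by ring
  -- the slack `δ_N = min(δ_X, ρN)`
  refine ⟨min δX (ENNReal.ofReal (ρ * N)), lt_min hδX (ENNReal.ofReal_pos.2 (by positivity)), ?_⟩
  intro Ψ hΨ
  have hΨX : periodicEnergy v Ψ ≤ periodicGroundStateEnergy v N L + δX :=
    hΨ.trans (add_le_add le_rfl (min_le_left _ _))
  have hΨE : periodicEnergy v Ψ ≤ ENNReal.ofReal ((A + 1) * ρ * N) := by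
    calc periodicEnergy v Ψ ≤ periodicGroundStateEnergy v N L + ENNReal.ofReal (ρ * N) :=
          hΨ.trans (add_le_add le_rfl (min_le_right _ _))
      _ ≤ ENNReal.ofReal (A * ρ * N) + ENNReal.ofReal (ρ * N) := add_le_add hE0 le_rfl
      _ = ENNReal.ofReal ((A + 1) * ρ * N) := by
          rw [← ENNReal.ofReal_add (by positivity) (by positivity)]
          exact congrArg ENNReal.ofReal (by ring)
  -- the counting step with `K = κ√ρL`, `C_ir = C√ρL`, `D = 4π²κ²ρ`
  set D : ℝ≥0∞ := ENNReal.ofReal (4 * Real.pi ^ 2 * κ ^ 2 * ρ) with hD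
  have hDpos : 0 < 4 * Real.pi ^ 2 * κ ^ 2 * ρ := by positivity
  have hD0 : D ≠ 0 := (ENNReal.ofReal_pos.2 hDpos).ne'
  refine condensate_ge_half hL (K := κ * Real.sqrt ρ * L) (Cir := C * Real.sqrt ρ * L)
    (by positivity) (by positivity) v Ψ hD0 ENNReal.ofReal_ne_top ?_ ?_ ?_ ?_
  · -- (IR) the hypothesis `IRBoundFor v`
    intro k hk0 hkK
    have hm : (fun x => ((Real.sqrt (L ^ 3))⁻¹ : ℂ) * cellWave L k x) = planeWaveMode L k :=
      funext fun x => (planeWaveMode_eq L k x).symm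
    have h : IRIneq C ρ N Ψ.ψ k := hXN Ψ hΨX k ⟨hk0, hkK⟩
    unfold IRIneq at h
    rwa [hm] at h
  · -- (UV) `4π²κ²ρ ≤ |2πk/L|²` off the window (`‖k‖_∞² ≤ |k|₂²`)
    intro k hk
    rw [hD, fracDispersion_two]
    refine ENNReal.ofReal_le_ofReal ?_
    have h1 : (κ * Real.sqrt ρ * L) ^ 2 < ∑ j, (k j : ℝ) ^ 2 := by
      calc (κ * Real.sqrt ρ * L) ^ 2 < ‖(fun i => (k i : ℝ))‖ ^ 2 := by gcongr
        _ ≤ ∑ j, (k j : ℝ) ^ 2 := ModeCounting.norm_sq_le_sum_sq k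
    rw [mul_pow, mul_pow, Real.sq_sqrt hρ.le] at h1
    rw [le_div_iff₀ (by positivity)]
    calc 4 * Real.pi ^ 2 * κ ^ 2 * ρ * L ^ 2 = 4 * Real.pi ^ 2 * (κ ^ 2 * ρ * L ^ 2) := by ring
      _ ≤ 4 * Real.pi ^ 2 * ∑ j, (k j : ℝ) ^ 2 := by gcongr
  · -- (T) `(E₀ + δ)/(4π²κ²ρ) ≤ (A+1)ρN/(4(A+1)ρ) = N/4`
    calc D⁻¹ * periodicEnergy v Ψ ≤ D⁻¹ * ENNReal.ofReal ((A + 1) * ρ * N) := by gcongr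
      _ = ENNReal.ofReal ((A + 1) * ρ * N / (4 * Real.pi ^ 2 * κ ^ 2 * ρ)) := by
          rw [← ENNReal.div_eq_inv_mul, hD, ← ENNReal.ofReal_div_of_pos hDpos]
      _ = ENNReal.ofReal (N / 4) := by
          congr 1
          rw [show 4 * Real.pi ^ 2 * κ ^ 2 * ρ = 4 * (Real.pi ^ 2 * κ ^ 2) * ρ by ring, hκ2]
          field_simp
  · -- (window) `C√ρL · 26 κ²ρL² = 26Cκ²√ρ·N ≤ N/4`
    have h1 : C * Real.sqrt ρ * L * (26 * (κ * Real.sqrt ρ * L) ^ 2) =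
        26 * C * κ ^ 2 * Real.sqrt ρ * (ρ * L ^ 3) := by
      rw [mul_pow, mul_pow, Real.sq_sqrt hρ.le]
      ring
    rw [h1, hL3]
    nlinarith [hsqrtρ, hNr.le]

end Summit.AtomisticToContinuum.BoseEinsteinCondensation.Theorems.LandauToPeriodicBEC

end
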